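import Literature.NumberTheory.Sieve.FordMaynardFramework
import Mathlib.Analysis.Normed.Module.FiniteDimension
import Mathlib.Topology.Algebra.Module.FiniteDimension
import Mathlib.MeasureTheory.Constructions.BorelSpace.Basic
import HarnessLib

/-!
# Polyhedral sets (finite intersections of half-spaces) — a coordinate-free form of Ford–Maynard's convex polytopes

Infrastructure for the piecewise-Lipschitz calculus behind Definition 6.2 (b) of K. Ford, J. Maynard,
*On the theory of prime producing sieves* (arXiv:2407.14368): a function class "finite sum of
functions each supported on a convex polytope and Lipschitz on it" is only usable once polytopes are
closed under the operations the constructions of §§6, 9 perform (intersections, preimages under linear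
maps, products with a second factor, boxes). Everything here is PROVED.

* `HalfRel s v b` — the scalar constraint `v < b` (`s = true`, strict) or `v ≤ b` (`s = false`).
* `IsPolyhedral Q` — `Q ⊆ E` is cut out by finitely many constraints `HalfRel sᵢ (φᵢ x) bᵢ` with
  `φᵢ : E →ₗ[ℝ] ℝ` linear (Definition 5.7 without the boundedness requirement and without coordinates);
  closure under `∩`, finite `⋂`, preimages by linear maps; half-spaces, `univ`, `∅`, coordinate boxes;
  measurability.
* `dotFunctional c` — the functional `x ↦ ∑ cᵢ xᵢ` on `Fin k → ℝ`; `coeffs φ` — the coefficients of a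
  functional; `IsConvexPolytope.isPolyhedral` and `IsPolyhedral.isConvexPolytope` (with boundedness)
  translate to and from the coordinate form `IsConvexPolytope` of `FordMaynardFramework.lean`.

## References

* K. Ford, J. Maynard, *On the theory of prime producing sieves*, arXiv:2407.14368v1 (2024), §5.3
  Definition 5.7, §6 Definition 6.2 (b). [FordMaynard2024PrimeSieves]
-/

noncomputable section

open Set

namespace Literature.NumberTheory.Sieve.FordMaynard

/-! ### Scalar constraints -/

/-- The scalar constraint of a half-space: `HalfRel true v b` is `v < b` (open half-space) and
`HalfRel false v b` is `v ≤ b` (closed half-space). [cite: FordMaynard2024PrimeSieves, Definition 5.7] -/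
def HalfRel : Bool → ℝ → ℝ → Prop
  | true, v, b => v < b
  | false, v, b => v ≤ b

/-- `HalfRel true` is `<`. [folklore] -/
@[simp] theorem halfRel_true (v b : ℝ) : HalfRel true v b ↔ v < b := Iff.rfl

/-- `HalfRel false` is `≤`. [folklore] -/
@[simp] theorem halfRel_false (v b : ℝ) : HalfRel false v b ↔ v ≤ b := Iff.rfl

/-- A constraint `v ⊲ b` implies `v ≤ b`. [folklore] -/
theorem HalfRel.le {s : Bool} {v b : ℝ} (h : HalfRel s v b) : v ≤ b := by
  cases s
  · exact h
  · exact le_of_lt h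

/-- A failed constraint `¬ (v ⊲ b)` implies `b ≤ v`. [folklore] -/
theorem HalfRel.ge_of_not {s : Bool} {v b : ℝ} (h : ¬ HalfRel s v b) : b ≤ v := by
  cases s
  · exact le_of_lt (not_le.1 h)
  · exact not_lt.1 h

/-- Constraints are downward closed in the value. [folklore] -/
theorem HalfRel.mono {s : Bool} {v v' b : ℝ} (h : HalfRel s v b) (hv : v' ≤ v) : HalfRel s v' b := by
  cases s
  · exact le_trans hv h
  · exact lt_of_le_of_lt hv h

/-- The set where a continuous function satisfies a scalar constraint is measurable (it is open or
closed). [folklore] -/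
theorem measurableSet_halfRel {X : Type*} [TopologicalSpace X] [MeasurableSpace X]
    [OpensMeasurableSpace X] (s : Bool) {f : X → ℝ} (hf : Continuous f) (b : ℝ) :
    MeasurableSet {x | HalfRel s (f x) b} := by
  cases s
  · exact (isClosed_le hf continuous_const).measurableSet
  · exact (isOpen_lt hf continuous_const).measurableSet

/-! ### Polyhedral sets -/

section Polyhedral

variable {E : Type*} [AddCommGroup E] [Module ℝ E]

/-- **Polyhedral sets**: `Q ⊆ E` is polyhedral if it is the set of solutions of finitely many linear
constraints `φᵢ x < bᵢ` or `φᵢ x ≤ bᵢ` (`φᵢ` linear functionals). Bounded polyhedral subsets of `ℝ^k`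
are exactly the convex polytopes of Definition 5.7 (`IsPolyhedral.isConvexPolytope`,
`IsConvexPolytope.isPolyhedral`). [cite: FordMaynard2024PrimeSieves, Definition 5.7] -/
def IsPolyhedral (Q : Set E) : Prop :=
  ∃ (ι : Type) (_ : Fintype ι) (φ : ι → E →ₗ[ℝ] ℝ) (b : ι → ℝ) (s : ι → Bool),
    Q = {x | ∀ i, HalfRel (s i) (φ i x) (b i)}

/-- A single half-space (open or closed) is polyhedral. [folklore] -/
theorem isPolyhedral_halfRel (s : Bool) (φ : E →ₗ[ℝ] ℝ) (b : ℝ) :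
    IsPolyhedral {x | HalfRel s (φ x) b} :=
  ⟨Unit, inferInstance, fun _ => φ, fun _ => b, fun _ => s, by ext x; simp⟩

/-- `{x | φ x < b}` is polyhedral. [folklore] -/
theorem isPolyhedral_lt (φ : E →ₗ[ℝ] ℝ) (b : ℝ) : IsPolyhedral {x | φ x < b} := by
  simpa using isPolyhedral_halfRel true φ b

/-- `{x | φ x ≤ b}` is polyhedral. [folklore] -/
theorem isPolyhedral_le (φ : E →ₗ[ℝ] ℝ) (b : ℝ) : IsPolyhedral {x | φ x ≤ b} := by
  simpa using isPolyhedral_halfRel false φ b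

/-- `{x | b < φ x}` is polyhedral. [folklore] -/
theorem isPolyhedral_gt (φ : E →ₗ[ℝ] ℝ) (b : ℝ) : IsPolyhedral {x | b < φ x} := by
  have := isPolyhedral_lt (-φ) (-b)
  simpa [neg_lt_neg_iff] using this

/-- `{x | b ≤ φ x}` is polyhedral. [folklore] -/
theorem isPolyhedral_ge (φ : E →ₗ[ℝ] ℝ) (b : ℝ) : IsPolyhedral {x | b ≤ φ x} := by
  have := isPolyhedral_le (-φ) (-b)
  simpa [neg_le_neg_iff] using this

/-- `{x | φ x < ψ x}` is polyhedral. [folklore] -/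
theorem isPolyhedral_lt₂ (φ ψ : E →ₗ[ℝ] ℝ) : IsPolyhedral {x | φ x < ψ x} := by
  have := isPolyhedral_lt (φ - ψ) 0
  simpa [sub_neg] using this

/-- `{x | φ x ≤ ψ x}` is polyhedral. [folklore] -/
theorem isPolyhedral_le₂ (φ ψ : E →ₗ[ℝ] ℝ) : IsPolyhedral {x | φ x ≤ ψ x} := by
  have := isPolyhedral_le (φ - ψ) 0
  simpa [sub_nonpos] using this

/-- The whole space is polyhedral (no constraint). [folklore] -/
theorem isPolyhedral_univ : IsPolyhedral (Set.univ : Set E) :=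
  ⟨Empty, inferInstance, Empty.elim, Empty.elim, Empty.elim, by ext x; simp⟩

/-- The empty set is polyhedral (`0 < 0`). [folklore] -/
theorem isPolyhedral_empty : IsPolyhedral (∅ : Set E) := by
  have := isPolyhedral_lt (0 : E →ₗ[ℝ] ℝ) 0
  simpa using this

/-- Intersections of polyhedral sets are polyhedral. [folklore] -/
theorem IsPolyhedral.inter {Q Q' : Set E} (hQ : IsPolyhedral Q) (hQ' : IsPolyhedral Q') :
    IsPolyhedral (Q ∩ Q') := by
  obtain ⟨ι, hι, φ, b, s, rfl⟩ := hQ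
  obtain ⟨ι', hι', φ', b', s', rfl⟩ := hQ'
  refine ⟨ι ⊕ ι', inferInstance, Sum.elim φ φ', Sum.elim b b', Sum.elim s s', ?_⟩
  ext x
  simp

/-- Finite intersections of polyhedral sets are polyhedral. [folklore] -/
theorem IsPolyhedral.iInter {κ : Type} [Fintype κ] {Q : κ → Set E} (h : ∀ k, IsPolyhedral (Q k)) :
    IsPolyhedral (⋂ k, Q k) := by
  choose ι hι φ b s hQ using h
  refine ⟨Σ k, ι k, inferInstance, fun p => φ p.1 p.2, fun p => b p.1 p.2, fun p => s p.1 p.2, ?_⟩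
  ext x
  simp only [Set.mem_iInter, Set.mem_setOf_eq, Sigma.forall]
  refine forall_congr' fun k => ?_
  rw [hQ k]
  rfl

/-- Sets defined by a finite conjunction of polyhedral conditions are polyhedral. [folklore] -/
theorem IsPolyhedral.setOf_forall {κ : Type} [Fintype κ] {P : κ → E → Prop}
    (h : ∀ k, IsPolyhedral {x | P k x}) : IsPolyhedral {x | ∀ k, P k x} := by
  have := IsPolyhedral.iInter h
  convert this using 1
  ext x
  simp

/-- Sets defined by a conjunction of two polyhedral conditions are polyhedral. [folklore] -/
theorem IsPolyhedral.setOf_and {P P' : E → Prop} (h : IsPolyhedral {x | P x})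
    (h' : IsPolyhedral {x | P' x}) : IsPolyhedral {x | P x ∧ P' x} := by
  rw [Set.setOf_and]
  exact h.inter h'

/-- A condition guarded by a decidable proposition is polyhedral if the condition is. [folklore] -/
theorem IsPolyhedral.setOf_imp {c : Prop} {P : E → Prop} (h : IsPolyhedral {x | P x}) :
    IsPolyhedral {x | c → P x} := by
  by_cases hc : c
  · convert h using 1
    ext x
    simp [hc]
  · convert (isPolyhedral_univ : IsPolyhedral (Set.univ : Set E)) using 1
    ext x
    simp [hc]

/-- Preimages of polyhedral sets under linear maps are polyhedral. [folklore] -/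
theorem IsPolyhedral.preimage {E' : Type*} [AddCommGroup E'] [Module ℝ E'] {Q : Set E}
    (hQ : IsPolyhedral Q) (A : E' →ₗ[ℝ] E) : IsPolyhedral (A ⁻¹' Q) := by
  obtain ⟨ι, hι, φ, b, s, rfl⟩ := hQ
  exact ⟨ι, hι, fun i => (φ i).comp A, b, s, by ext x; simp⟩

end Polyhedral

section Measurable

variable {E : Type*} [NormedAddCommGroup E] [NormedSpace ℝ E] [FiniteDimensional ℝ E]
  [MeasurableSpace E] [BorelSpace E]

/-- Polyhedral subsets of a finite-dimensional space are Borel measurable. [folklore] -/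
theorem IsPolyhedral.measurableSet {Q : Set E} (hQ : IsPolyhedral Q) : MeasurableSet Q := by
  obtain ⟨ι, hι, φ, b, s, rfl⟩ := hQ
  have : {x | ∀ i, HalfRel (s i) (φ i x) (b i)} = ⋂ i, {x | HalfRel (s i) (φ i x) (b i)} := by
    ext x; simp
  rw [this]
  exact MeasurableSet.iInter fun i =>
    measurableSet_halfRel (s i) (φ i).continuous_of_finiteDimensional (b i)

end Measurable

/-! ### Coordinates: functionals on `ℝ^k`, boxes, and the coordinate form of Definition 5.7 -/

section Coordinates

variable {k : ℕ}

/-- The linear functional `x ↦ ∑ᵢ cᵢ xᵢ` on `ℝ^k`. [folklore] -/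
def dotFunctional (c : Fin k → ℝ) : (Fin k → ℝ) →ₗ[ℝ] ℝ where
  toFun x := ∑ i, c i * x i
  map_add' x y := by
    simp only [Pi.add_apply, mul_add, Finset.sum_add_distrib]
  map_smul' a x := by
    simp only [Pi.smul_apply, smul_eq_mul, RingHom.id_apply, Finset.mul_sum]
    exact Finset.sum_congr rfl fun i _ => by ring

/-- `dotFunctional c x = ∑ᵢ cᵢ xᵢ`. [folklore] -/
@[simp] theorem dotFunctional_apply (c x : Fin k → ℝ) : dotFunctional c x = ∑ i, c i * x i := rfl

/-- The coefficients `φ(eᵢ)` of a linear functional on `ℝ^k`. [folklore] -/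
def coeffs (φ : (Fin k → ℝ) →ₗ[ℝ] ℝ) : Fin k → ℝ := fun i => φ (fun j => if i = j then 1 else 0)

/-- A linear functional on `ℝ^k` is `x ↦ ∑ᵢ φ(eᵢ) xᵢ`. [folklore] -/
theorem apply_eq_sum_coeffs (φ : (Fin k → ℝ) →ₗ[ℝ] ℝ) (x : Fin k → ℝ) :
    φ x = ∑ i, coeffs φ i * x i := by
  rw [LinearMap.pi_apply_eq_sum_univ φ x]
  exact Finset.sum_congr rfl fun i _ => by rw [smul_eq_mul, mul_comm]; rfl

/-- The coordinate projections `x ↦ xᵢ` as linear functionals. [folklore] -/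
def coordFunctional (i : Fin k) : (Fin k → ℝ) →ₗ[ℝ] ℝ := LinearMap.proj i

/-- `coordFunctional i x = xᵢ`. [folklore] -/
@[simp] theorem coordFunctional_apply (i : Fin k) (x : Fin k → ℝ) : coordFunctional i x = x i := rfl

/-- The coordinate box `{x | ∀ i, |xᵢ| ≤ R}` is polyhedral. [folklore] -/
theorem isPolyhedral_box (k : ℕ) (R : ℝ) : IsPolyhedral {x : Fin k → ℝ | ∀ i, |x i| ≤ R} := by
  have h1 : IsPolyhedral {x : Fin k → ℝ | ∀ i, x i ≤ R} :=
    IsPolyhedral.setOf_forall fun i => by simpa using isPolyhedral_le (coordFunctional i) R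
  have h2 : IsPolyhedral {x : Fin k → ℝ | ∀ i, -R ≤ x i} :=
    IsPolyhedral.setOf_forall fun i => by simpa using isPolyhedral_ge (coordFunctional i) (-R)
  convert h1.inter h2 using 1
  ext x
  simp only [Set.mem_setOf_eq, Set.mem_inter_iff, abs_le]
  exact ⟨fun h => ⟨fun i => (h i).2, fun i => (h i).1⟩, fun h i => ⟨h.2 i, h.1 i⟩⟩

/-- The coordinate box `{x | ∀ i, |xᵢ| ≤ R}` is bounded. [folklore] -/
theorem isBounded_box (k : ℕ) (R : ℝ) : Bornology.IsBounded {x : Fin k → ℝ | ∀ i, |x i| ≤ R} := by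
  rw [Metric.isBounded_iff_subset_closedBall 0]
  refine ⟨|R|, fun x hx => ?_⟩
  rw [Metric.mem_closedBall, dist_zero_right, pi_norm_le_iff_of_nonneg (abs_nonneg R)]
  intro i
  rw [Real.norm_eq_abs]
  exact (hx i).trans (le_abs_self R)

/-- In `ℝ^k`, a bounded set lies in a coordinate box. [folklore] -/
theorem exists_abs_le_of_isBounded {P : Set (Fin k → ℝ)} (hP : Bornology.IsBounded P) :
    ∃ R : ℝ, 0 ≤ R ∧ ∀ x ∈ P, ∀ i, |x i| ≤ R := by
  obtain ⟨R, hR⟩ := (Metric.isBounded_iff_subset_closedBall 0).1 hP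
  refine ⟨max R 0, le_max_right _ _, fun x hx i => ?_⟩
  have hx' := hR hx
  rw [Metric.mem_closedBall, dist_zero_right] at hx'
  have := (norm_le_pi_norm x i).trans hx'
  rw [Real.norm_eq_abs] at this
  exact this.trans (le_max_left _ _)

/-- A convex polytope in the coordinate sense of Definition 5.7 (`IsConvexPolytope`) is polyhedral.
[cite: FordMaynard2024PrimeSieves, Definition 5.7] -/
theorem IsConvexPolytope.isPolyhedral {P : Set (Fin k → ℝ)} (hP : IsConvexPolytope P) :
    IsPolyhedral P := by
  obtain ⟨-, S, T, rfl⟩ := hP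
  refine ⟨{c // c ∈ S} ⊕ {c // c ∈ T}, inferInstance,
    Sum.elim (fun c => dotFunctional c.1.1) (fun c => dotFunctional c.1.1),
    Sum.elim (fun c => c.1.2) (fun c => c.1.2), Sum.elim (fun _ => true) (fun _ => false), ?_⟩
  ext x
  simp only [Set.mem_setOf_eq, Sum.forall, Sum.elim_inl, Sum.elim_inr, halfRel_true,
    halfRel_false, dotFunctional_apply, Subtype.forall, Prod.forall]

/-- A bounded polyhedral subset of `ℝ^k` is a convex polytope in the coordinate sense of
Definition 5.7 (`IsConvexPolytope`). [cite: FordMaynard2024PrimeSieves, Definition 5.7] -/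
theorem IsPolyhedral.isConvexPolytope {P : Set (Fin k → ℝ)} (hP : IsPolyhedral P)
    (hB : Bornology.IsBounded P) : IsConvexPolytope P := by
  classical
  obtain ⟨ι, hι, φ, b, s, rfl⟩ := hP
  refine ⟨hB, (Finset.univ.filter fun i => s i = true).image fun i => (coeffs (φ i), b i),
    (Finset.univ.filter fun i => s i = false).image fun i => (coeffs (φ i), b i), ?_⟩
  ext x
  simp only [Set.mem_setOf_eq, Finset.mem_image, Finset.mem_filter, Finset.mem_univ, true_and,
    forall_exists_index, and_imp]
  constructor
  · intro h
    refine ⟨?_, ?_⟩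
    · rintro c i hi rfl
      have := h i
      rw [hi, halfRel_true, apply_eq_sum_coeffs] at this
      exact this
    · rintro c i hi rfl
      have := h i
      rw [hi, halfRel_false, apply_eq_sum_coeffs] at this
      exact this
  · rintro ⟨h1, h2⟩ i
    cases hs : s i
    · rw [halfRel_false, apply_eq_sum_coeffs]
      exact h2 _ i hs rfl
    · rw [halfRel_true, apply_eq_sum_coeffs]
      exact h1 _ i hs rfl

end Coordinates

end Literature.NumberTheory.Sieve.FordMaynard
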